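import Summits.AtomisticToContinuum.FouriersLaw.Theorems.OddSectorIrreversibilityWitnessGlueClosedFlow

/-!
# `WitnessGlue` (stmt-AtomisticToContinuum-14072) — support 2: `E3` bounds the tangent entry in `L²(μ_T)`; two `L²` inequalities

Support file for `OddSectorIrreversibility.WitnessGlue`. The crux `ClosedConeSensitivity` (E3) is,
through the zero-friction dictionary, a Gibbs mean-square bound on FINITE DIFFERENCES of the
transported current `j_i ∘ Φ_t` under momentum kicks of size `s ∈ (0,1]` at a contact, carrying the
factor `s²`. Fatou along `s = 1/(n+1)` turns it into the same bound for the momentum partial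
derivative `∂_{p_b}(j_i ∘ Φ_t)` (Lean's `deriv`, which is the junk value `0` at points of
non-differentiability — this only helps), which is the quantity paired with `∂_{p_b} u⁺` in the leak
identity of `CorrectorTheory`. Adapted from the standing disprover's
`Cruxes/ClosedConeSensitivity/Disproof.lean` §3 (sorry-free parts). Also: Cauchy–Schwarz for real
square-integrable functions and a junk-proof `ℝ≥0∞` Jensen inequality. No route statement is asserted.
-/

noncomputable section

namespace Summit.AtomisticToContinuum.FouriersLaw.Theorems.OddSectorWitness

open MeasureTheory Filter Topology ProbabilityTheory Set
open scoped NNReal ENNReal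
open Literature.MathematicalPhysics.KineticTheory.HeatConduction
open Summit.AtomisticToContinuum.FouriersLaw.Theorems.ClosedConeSensitivity.Negative.ZeroFrictionDictionary

variable {ω₂ lam β : ℝ} (hω : 0 < ω₂) (hl : 0 ≤ lam) (hβ : 0 ≤ β)
include hω hl hβ

/-! ## `E3` ⇒ Gibbs mean-square bound on the tangent entry `∂_{p_b}(j_i ∘ Φ_t)` -/

section Tangent

variable (N : ℕ)

omit hω hl hβ in
/-- A momentum partial derivative of a continuous observable is measurable (measurability of the
derivative with a parameter). [folklore] -/
theorem measurable_partialP {F : PhaseSpace N → ℝ} (hF : Continuous F) (b : Fin N) :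
    Measurable (partialP b F) := by
  have hf : Continuous (Function.uncurry fun (x : PhaseSpace N) (r : ℝ) => F (x.1, Function.update x.2 b r)) := by
    refine hF.comp ?_
    refine (continuous_fst.comp continuous_fst).prodMk ?_
    have h1 : Continuous fun p : PhaseSpace N × ℝ => p.1.2 := continuous_snd.comp continuous_fst
    have h2 : Continuous fun p : PhaseSpace N × ℝ => p.2 := continuous_snd
    simpa [Function.uncurry] using h1.update b h2
  have hm := measurable_deriv_with_param hf
  have hx : Measurable fun x : PhaseSpace N => (x, x.2 b) :=
    measurable_id.prodMk ((measurable_pi_apply b).comp measurable_snd)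
  exact hm.comp hx

omit hω hl hβ in
/-- **Fatou comparison, pointwise.** The square of the momentum partial derivative is dominated by
the `liminf` of the squared difference quotients along `s = 1/(n+1)`: equality at points of
differentiability, and the derivative is the junk value `0` elsewhere. [folklore] -/
theorem ofReal_partialP_sq_le_liminf (F : PhaseSpace N → ℝ) (b : Fin N) (x : PhaseSpace N) :
    ENNReal.ofReal ((partialP b F x) ^ 2) ≤
      liminf (fun n : ℕ => ENNReal.ofReal (((n : ℝ) + 1) ^ 2 *
        (F (x.1, Function.update x.2 b (x.2 b + 1 / ((n : ℝ) + 1))) - F x) ^ 2)) atTop := by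
  set φ : ℝ → ℝ := fun r => F (x.1, Function.update x.2 b r) with hφ
  have hφx : φ (x.2 b) = F x := by simp [φ]
  have hpart : partialP b F x = deriv φ (x.2 b) := rfl
  by_cases hd : DifferentiableAt ℝ φ (x.2 b)
  · -- the difference quotients converge to the derivative
    have hslope := hd.hasDerivAt.tendsto_slope_zero
    have hseq : Tendsto (fun n : ℕ => 1 / ((n : ℝ) + 1)) atTop (𝓝[≠] 0) := by
      refine tendsto_nhdsWithin_iff.2 ⟨tendsto_one_div_add_atTop_nhds_zero_nat, Eventually.of_forall fun n => ?_⟩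
      have : (0 : ℝ) < 1 / ((n : ℝ) + 1) := by positivity
      exact this.ne'
    have hlim : Tendsto (fun n : ℕ => ((n : ℝ) + 1) * (φ (x.2 b + 1 / ((n : ℝ) + 1)) - φ (x.2 b))) atTop
        (𝓝 (deriv φ (x.2 b))) := by
      have := hslope.comp hseq
      refine this.congr fun n => ?_
      simp only [Function.comp_apply, smul_eq_mul, one_div, inv_inv]
    have hlim2 : Tendsto (fun n : ℕ => ENNReal.ofReal ((((n : ℝ) + 1) *
        (φ (x.2 b + 1 / ((n : ℝ) + 1)) - φ (x.2 b))) ^ 2)) atTop (𝓝 (ENNReal.ofReal ((deriv φ (x.2 b)) ^ 2))) :=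
      ENNReal.tendsto_ofReal ((hlim.pow 2))
    rw [hpart, ← hlim2.liminf_eq]
    refine le_of_eq (liminf_congr (Eventually.of_forall fun n => ?_))
    rw [hφx, mul_pow]
  · rw [hpart, deriv_zero_of_not_differentiableAt hd]
    simp

omit hω hl hβ in
/-- A momentum kick is an added unit vector. [folklore] -/
theorem update_eq_add_single (p : Fin N → ℝ) (b : Fin N) (s : ℝ) :
    Function.update p b (p b + s) = p + Pi.single b s := by
  -- adapted from Cruxes/ClosedConeSensitivity/Disproof.lean
  funext i
  by_cases h : i = b
  · subst h; simp
  · simp [Function.update_of_ne h, Pi.single_eq_of_ne h]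

/-- Energy of the kicked state: `H(q, p + s e_b) ≤ 2 H(q,p) + s²`. [folklore] -/
theorem hamiltonian_kick_le (γ : ℝ) (x : PhaseSpace N) (b : Fin N) (s : ℝ) :
    (pinnedChain ω₂ lam β γ).hamiltonian N (x.1, Function.update x.2 b (x.2 b + s)) ≤
      2 * (pinnedChain ω₂ lam β γ).hamiltonian N x + s ^ 2 := by
  -- adapted from Cruxes/ClosedConeSensitivity/Disproof.lean
  rw [update_eq_add_single, (pinnedChain ω₂ lam β γ).hamiltonian_add_momentum N x (Pi.single b s)]
  have hsum : ∑ i, (x.2 i * (Pi.single b s : Fin N → ℝ) i + (Pi.single b s : Fin N → ℝ) i ^ 2 / 2) =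
      x.2 b * s + s ^ 2 / 2 := by
    rw [Finset.sum_eq_single b]
    · simp
    · intro i _ hi; simp [Pi.single_eq_of_ne hi]
    · intro h; exact absurd (Finset.mem_univ _) h
  rw [hsum]
  have hp : x.2 b ^ 2 ≤ 2 * (pinnedChain ω₂ lam β γ).hamiltonian N x :=
    le_trans (Finset.single_le_sum (f := fun i => x.2 i ^ 2) (fun i _ => sq_nonneg _) (Finset.mem_univ b))
      (pinnedChain_sum_sq_le_two_mul_hamiltonian hω hl hβ N x)
  nlinarith [sq_nonneg (x.2 b - s)]

omit hω hl hβ in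
/-- The kick map `x ↦ (q, p + s e_b)` is continuous. [folklore] -/
theorem continuous_kick (b : Fin N) (s : ℝ) :
    Continuous fun x : PhaseSpace N => (x.1, Function.update x.2 b (x.2 b + s)) := by
  have h : (fun x : PhaseSpace N => (x.1, Function.update x.2 b (x.2 b + s))) =
      fun x => (x.1, x.2 + Pi.single b s) := funext fun x => by rw [update_eq_add_single]
  rw [h]
  fun_prop

/-- Pointwise majorant for the squared finite difference of a transported current under a kick of
size `s ∈ [0,1]`: `(Δ_s (j_i∘Φ_t))² ≤ 34 M² (1 + H)⁴`, `M = N(3+β)/2`. [folklore] -/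
theorem sqDiff_le (γ : ℝ) (i b : Fin N) (t : ℝ) {s : ℝ} (hs0 : 0 ≤ s) (hs1 : s ≤ 1) (x : PhaseSpace N) :
    ((pinnedChain ω₂ lam β γ).bondCurrent N i (detFlow ω₂ lam β N t (x.1, Function.update x.2 b (x.2 b + s))) -
        (pinnedChain ω₂ lam β γ).bondCurrent N i (detFlow ω₂ lam β N t x)) ^ 2 ≤
      34 * (N * ((3 + β) / 2)) ^ 2 * (1 + (pinnedChain ω₂ lam β γ).hamiltonian N x) ^ 4 := by
  -- adapted from Cruxes/ClosedConeSensitivity/Disproof.lean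
  set P := pinnedChain ω₂ lam β γ
  set y : PhaseSpace N := (x.1, Function.update x.2 b (x.2 b + s))
  set A := P.bondCurrent N i (detFlow ω₂ lam β N t y)
  set B := P.bondCurrent N i (detFlow ω₂ lam β N t x)
  set M : ℝ := N * ((3 + β) / 2)
  have hH0 : 0 ≤ P.hamiltonian N x := pinnedChain_hamiltonian_nonneg hω.le hl hβ γ N x
  have hHy0 : 0 ≤ P.hamiltonian N y := pinnedChain_hamiltonian_nonneg hω.le hl hβ γ N y
  have hA : |A| ≤ M * (1 + P.hamiltonian N y) ^ 2 := by
    have := abs_bondCurrent_detFlow_le hω hl hβ N γ i t y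
    simpa [M, mul_assoc] using this
  have hB : |B| ≤ M * (1 + P.hamiltonian N x) ^ 2 := by
    have := abs_bondCurrent_detFlow_le hω hl hβ N γ i t x
    simpa [M, mul_assoc] using this
  have hy : 1 + P.hamiltonian N y ≤ 2 * (1 + P.hamiltonian N x) := by
    have := hamiltonian_kick_le hω hl hβ N γ x b s
    have hs2 : s ^ 2 ≤ 1 := by nlinarith
    simp only [y] at this ⊢
    linarith
  have hM : 0 ≤ M := by positivity
  have hA2 : A ^ 2 ≤ M ^ 2 * (2 * (1 + P.hamiltonian N x)) ^ 4 := by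
    have h1 : A ^ 2 ≤ (M * (1 + P.hamiltonian N y) ^ 2) ^ 2 := by
      rw [← sq_abs A]; exact pow_le_pow_left₀ (abs_nonneg _) hA 2
    have h2 : (1 + P.hamiltonian N y) ^ 2 ≤ (2 * (1 + P.hamiltonian N x)) ^ 2 :=
      pow_le_pow_left₀ (by linarith) hy 2
    calc A ^ 2 ≤ (M * (1 + P.hamiltonian N y) ^ 2) ^ 2 := h1
      _ = M ^ 2 * ((1 + P.hamiltonian N y) ^ 2) ^ 2 := by ring
      _ ≤ M ^ 2 * ((2 * (1 + P.hamiltonian N x)) ^ 2) ^ 2 := by gcongr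
      _ = M ^ 2 * (2 * (1 + P.hamiltonian N x)) ^ 4 := by ring
  have hB2 : B ^ 2 ≤ M ^ 2 * (1 + P.hamiltonian N x) ^ 4 := by
    have h1 : B ^ 2 ≤ (M * (1 + P.hamiltonian N x) ^ 2) ^ 2 := by
      rw [← sq_abs B]; exact pow_le_pow_left₀ (abs_nonneg _) hB 2
    calc B ^ 2 ≤ (M * (1 + P.hamiltonian N x) ^ 2) ^ 2 := h1
      _ = M ^ 2 * (1 + P.hamiltonian N x) ^ 4 := by ring
  have hAB : (A - B) ^ 2 ≤ 2 * A ^ 2 + 2 * B ^ 2 := by nlinarith [sq_nonneg (A + B)]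
  calc (A - B) ^ 2 ≤ 2 * A ^ 2 + 2 * B ^ 2 := hAB
    _ ≤ 2 * (M ^ 2 * (2 * (1 + P.hamiltonian N x)) ^ 4) + 2 * (M ^ 2 * (1 + P.hamiltonian N x) ^ 4) := by
        gcongr
    _ = 34 * M ^ 2 * (1 + P.hamiltonian N x) ^ 4 := by ring

/-- The squared finite difference is integrable against the Gibbs weight (so the Bochner integral in
`ClosedConeSensitivity` is an honest one). [folklore] -/
theorem integrable_sqDiff (γ : ℝ) (i b : Fin N) (t : ℝ) {s : ℝ} (hs0 : 0 ≤ s) (hs1 : s ≤ 1) {T : ℝ}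
    (hT : 0 < T) :
    Integrable (fun x : PhaseSpace N =>
      ((pinnedChain ω₂ lam β γ).bondCurrent N i (detFlow ω₂ lam β N t (x.1, Function.update x.2 b (x.2 b + s))) -
        (pinnedChain ω₂ lam β γ).bondCurrent N i (detFlow ω₂ lam β N t x)) ^ 2) (gibbsWeight ω₂ lam β γ N T) := by
  have hj := pinnedChain_continuous_bondCurrent ω₂ lam β γ N i
  have hΦ := continuous_detFlow hω hl hβ N t
  have hk := continuous_kick N b s
  have hc : Continuous fun x : PhaseSpace N =>
      ((pinnedChain ω₂ lam β γ).bondCurrent N i (detFlow ω₂ lam β N t (x.1, Function.update x.2 b (x.2 b + s))) -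
        (pinnedChain ω₂ lam β γ).bondCurrent N i (detFlow ω₂ lam β N t x)) ^ 2 :=
    ((hj.comp (hΦ.comp hk)).sub (hj.comp hΦ)).pow 2
  refine integrable_of_abs_le_pow hω hl hβ γ N hT hc.aestronglyMeasurable (34 * (N * ((3 + β) / 2)) ^ 2) 4
    fun x => ?_
  rw [abs_of_nonneg (sq_nonneg _)]
  exact sqDiff_le hω hl hβ N γ i b t hs0 hs1 x

/-- **`E3` ⇒ the mean-square tangent bound.** If the cone bound `ConeBoundAt` (the body of
`ClosedConeSensitivity` read through the zero-friction dictionary) holds with constants `(a, κ, C)`,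
then for every bond `i`, contact `b`, and time `0 ≤ t ≤ a·d` the Gibbs mean square of the momentum
partial derivative `∂_{p_b}(j_i ∘ Φ_t)` is at most `C e^{-κ(d - t/a)} Z` (Fatou along `s = 1/(n+1)`;
at points of non-differentiability the derivative is the junk value `0`, which only helps). [folklore] -/
theorem lintegral_partialP_transport_sq_le {γ T a κ C : ℝ} (hT : 0 < T)
    (hcone : ConeBoundAt ω₂ lam β γ T a κ C) (i b : Fin N) (hb : b.val = 0 ∨ b.val = N - 1)
    {t : ℝ} (ht : 0 ≤ t) (htd : t ≤ a * ((if b.val = 0 then i.val else N - 2 - i.val : ℕ) : ℝ)) :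
    ∫⁻ x, ENNReal.ofReal ((partialP b (fun y => (pinnedChain ω₂ lam β γ).bondCurrent N i (detFlow ω₂ lam β N t y)) x) ^ 2)
        ∂(gibbsWeight ω₂ lam β γ N T) ≤
      ENNReal.ofReal (C * Real.exp (-(κ * (((if b.val = 0 then i.val else N - 2 - i.val : ℕ) : ℝ) - t / a))) *
        ∫ x, Real.exp (-((pinnedChain ω₂ lam β γ).hamiltonian N x) / T) ∂volume) := by
  -- adapted from `tangentConeBound_of_closedConeSensitivity` in Cruxes/ClosedConeSensitivity/Disproof.lean
  set P := pinnedChain ω₂ lam β γ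
  set d : ℕ := if b.val = 0 then i.val else N - 2 - i.val
  set F : PhaseSpace N → ℝ := fun y => P.bondCurrent N i (detFlow ω₂ lam β N t y)
  have hn : ∀ n : ℕ,
      ∫⁻ x, ENNReal.ofReal (((n : ℝ) + 1) ^ 2 *
          (F (x.1, Function.update x.2 b (x.2 b + 1 / ((n : ℝ) + 1))) - F x) ^ 2) ∂(gibbsWeight ω₂ lam β γ N T)
        ≤ ENNReal.ofReal (C * Real.exp (-(κ * ((d : ℝ) - t / a))) *
            ∫ x, Real.exp (-(P.hamiltonian N x) / T) ∂volume) := by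
    intro n
    have hn0 : (0 : ℝ) < (n : ℝ) + 1 := by positivity
    have hs0 : (0 : ℝ) < 1 / ((n : ℝ) + 1) := by positivity
    have hs1 : 1 / ((n : ℝ) + 1) ≤ 1 := by
      rw [div_le_one hn0]; linarith [n.cast_nonneg (α := ℝ)]
    have HE := hcone N i b t (1 / ((n : ℝ) + 1)) hb ht hs0 hs1 htd
    have hint := integrable_sqDiff hω hl hβ N γ i b t hs0.le hs1 hT
    have hnn : 0 ≤ᵐ[gibbsWeight ω₂ lam β γ N T] fun x => ((n : ℝ) + 1) ^ 2 *
        (F (x.1, Function.update x.2 b (x.2 b + 1 / ((n : ℝ) + 1))) - F x) ^ 2 :=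
      Eventually.of_forall fun x => by positivity
    rw [← ofReal_integral_eq_lintegral_ofReal (hint.const_mul _) hnn, integral_const_mul]
    apply ENNReal.ofReal_le_ofReal
    calc ((n : ℝ) + 1) ^ 2 * _ ≤ ((n : ℝ) + 1) ^ 2 * (C * (1 / ((n : ℝ) + 1)) ^ 2 *
          Real.exp (-(κ * ((d : ℝ) - t / a))) * ∫ x, Real.exp (-(P.hamiltonian N x) / T) ∂volume) :=
          mul_le_mul_of_nonneg_left HE (by positivity)
      _ = C * Real.exp (-(κ * ((d : ℝ) - t / a))) * ∫ x, Real.exp (-(P.hamiltonian N x) / T) ∂volume := by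
          field_simp
  have hmeas : ∀ n : ℕ, Measurable fun x : PhaseSpace N => ENNReal.ofReal (((n : ℝ) + 1) ^ 2 *
      (F (x.1, Function.update x.2 b (x.2 b + 1 / ((n : ℝ) + 1))) - F x) ^ 2) := by
    intro n
    have hj := pinnedChain_continuous_bondCurrent ω₂ lam β γ N i
    have hΦ := continuous_detFlow hω hl hβ N t
    have hk := continuous_kick N b (1 / ((n : ℝ) + 1))
    exact (continuous_const.mul (((hj.comp (hΦ.comp hk)).sub (hj.comp hΦ)).pow 2)).measurable.ennreal_ofReal
  calc _ ≤ ∫⁻ x, liminf (fun n : ℕ => ENNReal.ofReal (((n : ℝ) + 1) ^ 2 *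
          (F (x.1, Function.update x.2 b (x.2 b + 1 / ((n : ℝ) + 1))) - F x) ^ 2)) atTop
            ∂(gibbsWeight ω₂ lam β γ N T) :=
        lintegral_mono fun x => ofReal_partialP_sq_le_liminf N F b x
    _ ≤ liminf (fun n : ℕ => ∫⁻ x, ENNReal.ofReal (((n : ℝ) + 1) ^ 2 *
          (F (x.1, Function.update x.2 b (x.2 b + 1 / ((n : ℝ) + 1))) - F x) ^ 2) ∂(gibbsWeight ω₂ lam β γ N T)) atTop :=
        lintegral_liminf_le hmeas
    _ ≤ _ := liminf_le_of_frequently_le' (Eventually.of_forall hn).frequently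

/-- The tangent entry `∂_{p_b}(j_i ∘ Φ_t)` is in `L²(μ_T)` inside the cone, with the bound of
`lintegral_partialP_transport_sq_le` on its squared norm. [folklore] -/
theorem memLp_partialP_transport {γ T a κ C : ℝ} (hT : 0 < T)
    (hcone : ConeBoundAt ω₂ lam β γ T a κ C) (i b : Fin N) (hb : b.val = 0 ∨ b.val = N - 1)
    {t : ℝ} (ht : 0 ≤ t) (htd : t ≤ a * ((if b.val = 0 then i.val else N - 2 - i.val : ℕ) : ℝ)) :
    MemLp (partialP b (fun y => (pinnedChain ω₂ lam β γ).bondCurrent N i (detFlow ω₂ lam β N t y))) 2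
      (gibbsWeight ω₂ lam β γ N T) := by
  have hF : Continuous fun y => (pinnedChain ω₂ lam β γ).bondCurrent N i (detFlow ω₂ lam β N t y) :=
    (pinnedChain_continuous_bondCurrent ω₂ lam β γ N i).comp (continuous_detFlow hω hl hβ N t)
  have hm := measurable_partialP N hF b
  refine (memLp_two_iff_integrable_sq hm.aestronglyMeasurable).2 ⟨(hm.pow_const 2).aestronglyMeasurable, ?_⟩
  have h := lintegral_partialP_transport_sq_le hω hl hβ N hT hcone i b hb ht htd
  refine lt_of_le_of_lt ?_ (h.trans_lt ENNReal.ofReal_lt_top)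
  refine lintegral_mono fun x => ?_
  rw [Real.enorm_eq_ofReal (sq_nonneg _)]

end Tangent

/-! ## Two elementary `L²` inequalities -/

section L2

variable {X : Type*} [MeasurableSpace X] {ν : Measure X}

omit hω hl hβ in
/-- **Cauchy–Schwarz** for real square-integrable functions:
`|∫ f g| ≤ √(∫ f²) · √(∫ g²)`. [folklore] -/
theorem abs_integral_mul_le_sqrt {f g : X → ℝ} (hf : MemLp f 2 ν) (hg : MemLp g 2 ν) :
    |∫ x, f x * g x ∂ν| ≤ Real.sqrt (∫ x, (f x) ^ 2 ∂ν) * Real.sqrt (∫ x, (g x) ^ 2 ∂ν) := by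
  have h2 : ENNReal.ofReal (2 : ℝ) = 2 := by simp
  have hf' : MemLp (fun x => |f x|) (ENNReal.ofReal 2) ν := by rw [h2]; exact hf.abs
  have hg' : MemLp (fun x => |g x|) (ENNReal.ofReal 2) ν := by rw [h2]; exact hg.abs
  have hH := integral_mul_le_Lp_mul_Lq_of_nonneg Real.HolderConjugate.two_two
    (Eventually.of_forall fun x => abs_nonneg (f x)) (Eventually.of_forall fun x => abs_nonneg (g x)) hf' hg'
  have hsq : ∀ (h : X → ℝ), (∫ x, |h x| ^ (2 : ℝ) ∂ν) ^ (1 / (2 : ℝ)) = Real.sqrt (∫ x, (h x) ^ 2 ∂ν) := by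
    intro h
    rw [Real.sqrt_eq_rpow]
    congr 1
    refine integral_congr_ae (Eventually.of_forall fun x => ?_)
    simp only [Real.rpow_two, sq_abs]
  rw [hsq f, hsq g] at hH
  calc |∫ x, f x * g x ∂ν| ≤ ∫ x, |f x * g x| ∂ν := abs_integral_le_integral_abs
    _ = ∫ x, |f x| * |g x| ∂ν := by simp only [abs_mul]
    _ ≤ _ := hH

omit hω hl hβ in
/-- **Jensen / Cauchy–Schwarz in `ℝ≥0∞` form, junk-proof.** For a finite measure and an
a.e.-strongly measurable real `f`: `ofReal ((∫ f)²) ≤ ν(univ) · ∫⁻ ofReal (f²)` — if `f ∉ L¹` the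
left side is `0`, if `f ∈ L¹ \ L²` the right side is `∞`. [folklore] -/
theorem ofReal_sq_integral_le [IsFiniteMeasure ν] {f : X → ℝ} (hf : AEStronglyMeasurable f ν) :
    ENNReal.ofReal ((∫ x, f x ∂ν) ^ 2) ≤ ν univ * ∫⁻ x, ENNReal.ofReal ((f x) ^ 2) ∂ν := by
  by_cases h2 : MemLp f 2 ν
  · have h1 : MemLp (fun _ : X => (1 : ℝ)) 2 ν := memLp_const 1
    have hcs := abs_integral_mul_le_sqrt h2 h1
    simp only [mul_one, one_pow, integral_const, smul_eq_mul] at hcs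
    have hint : Integrable (fun x => (f x) ^ 2) ν := (memLp_two_iff_integrable_sq hf).1 h2
    have hnn : 0 ≤ ∫ x, (f x) ^ 2 ∂ν := integral_nonneg fun x => sq_nonneg _
    rw [← ofReal_integral_eq_lintegral_ofReal hint (Eventually.of_forall fun x => sq_nonneg _)]
    have hsq : (∫ x, f x ∂ν) ^ 2 ≤ ν.real univ * ∫ x, (f x) ^ 2 ∂ν := by
      have hr : 0 ≤ ν.real univ := measureReal_nonneg
      calc (∫ x, f x ∂ν) ^ 2 = |∫ x, f x ∂ν| ^ 2 := (sq_abs _).symm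
        _ ≤ (Real.sqrt (∫ x, (f x) ^ 2 ∂ν) * Real.sqrt (ν.real univ)) ^ 2 :=
            pow_le_pow_left₀ (abs_nonneg _) hcs 2
        _ = ν.real univ * ∫ x, (f x) ^ 2 ∂ν := by
            rw [mul_pow, Real.sq_sqrt hnn, Real.sq_sqrt hr]; ring
    calc ENNReal.ofReal ((∫ x, f x ∂ν) ^ 2) ≤ ENNReal.ofReal (ν.real univ * ∫ x, (f x) ^ 2 ∂ν) :=
          ENNReal.ofReal_le_ofReal hsq
      _ = ν univ * ENNReal.ofReal (∫ x, (f x) ^ 2 ∂ν) := by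
          rw [ENNReal.ofReal_mul measureReal_nonneg, Measure.real, ENNReal.ofReal_toReal (measure_ne_top ν _)]
  · by_cases h1 : Integrable f ν
    · -- `f ∈ L¹ \ L²`: the right-hand side is infinite unless `ν = 0`
      have hinf : ∫⁻ x, ENNReal.ofReal ((f x) ^ 2) ∂ν = ⊤ := by
        by_contra hne
        apply h2
        refine (memLp_two_iff_integrable_sq hf).2 ⟨(hf.pow 2), ?_⟩
        rw [hasFiniteIntegral_iff_enorm]
        calc ∫⁻ x, ‖f x ^ 2‖ₑ ∂ν = ∫⁻ x, ENNReal.ofReal ((f x) ^ 2) ∂ν :=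
              lintegral_congr fun x => Real.enorm_eq_ofReal (sq_nonneg _)
          _ < ⊤ := lt_top_iff_ne_top.2 hne
      rw [hinf]
      by_cases hν : ν univ = 0
      · have hν0 : ν = 0 := Measure.measure_univ_eq_zero.1 hν
        simp [hν0]
      · rw [ENNReal.mul_top hν]
        exact le_top
    · simp [integral_undef h1]

end L2

end Summit.AtomisticToContinuum.FouriersLaw.Theorems.OddSectorWitness
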